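import Mathlib
import HarnessLib
import Literature.Analysis.FluidPDE.ClassicalSolution
import Literature.Analysis.FluidPDE.Vorticity
import Literature.Analysis.FluidPDE.TaoEnstrophyLocalisation
import Summits.NavierStokesRegularity.NavierStokesRegularity.Theorems.QuarterLogPincerEmberCensusHotWitnessFar
import Summits.NavierStokesRegularity.NavierStokesRegularity.Theorems.QuarterLogPincerFlatChainDefs

/-!
# Route `QuarterLogPincer`, crux `TypeIQuantSubcubicExp` (stmt-NavierStokesRegularity-24077), line `flat_chain` —
# S3 `stub_typeIEpoch : TypeIEpoch` (epochs of regularity are free under the Type-I rate)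

Registered stub S3 of ns-idea-7 g14's skeleton `Cruxes/TypeIQuantSubcubicExp/Lines/flat_chain.lean` (v1.1), proved BY
NAME over the objects home `Theorems/QuarterLogPincerFlatChainDefs.lean` (`EpochBlock`, `TypeIEpoch`, namespace
`…Cruxes.TypeIQuantSubcubicExp.FlatChain`).

Statement (S3, verbatim): for every `M` there is `Ce = Ce(M) ≥ 1` such that for every depth divisor `D ≥ 8`, in
the crux frame (classical solution on `[0,T] × ℝ³`, `ν = 1`, unforced, every `H^m` seminorm bounded) with the
virtual Type-I rate `‖u(t,x)‖ ≤ M (T+τ−t)^{-1/2}` (`τ > 0`), every horizon `t₁ ∈ (0,T]` and scale `0 < s ≤ t₁`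
carry the EPOCH BLOCK `EpochBlock Ce D u t₁ s`: on `[t₁ − 4s/D, t₁ − s/D]`, everywhere in space,
`‖u‖ ≤ Ce (s/D)^{-1/2}`, `‖∇u‖ ≤ Ce (s/D)⁻¹`, `‖ω‖ ≤ Ce (s/D)⁻¹`, `‖∇ω‖ ≤ Ce (s/D)^{-3/2}`.

Proof (`epochBlock_of_typeI`): write `σ := s/D`.  Since `D ≥ 8` and `s ≤ t₁`, `8σ ≤ t₁`, so the block
`[t₁ − 4σ, t₁ − σ]` lies above `4σ`.  At the horizon `t₁ − σ ≤ T` the virtual clock exceeds `r := √σ`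
(`r² = σ < T + τ − (t₁ − σ)`), so the tree's clock-far smoothing estimate
`EmberCensus.norm_iteratedFDeriv_le_of_typeI_far` (E1a file, from KNSS 2009 Prop. 4.1 in the scale-invariant form
`exists_norm_iteratedFDeriv_le_of_speed_le`) gives `‖Dᵏu(t)(x)‖ ≤ C_k (M'/√σ)^{k+1}` for `k ≤ 2` on
`((√σ/M')², t₁ − σ] ⊇ [t₁ − 4σ, t₁ − σ]`, `M' := max M 1`.  The vorticity clauses follow from
`‖curl v‖ ≤ ‖curlCLM‖‖Dv‖` and `‖D(curl v)‖ ≤ ‖curlCLM‖‖D²v‖` (`norm_curl_le`, `norm_fderiv_curl_le`), and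
`(M'/√σ)^{k+1} = M'^{k+1} σ^{-(k+1)/2}`.  Constant: `Ce := (1 + ‖curlCLM‖)(C₀ + C₁ + C₂ + 1)·M'³`.

HONEST FRAMING: a smoothing bookkeeping lemma about HYPOTHETICAL Type-I classical solutions; it closes one
registered stub (S3, size M) of a line whose load-bearing stubs (S2 port, S2 → S1, S4′, β) and whose census
node `SliceCensus` are OPEN; nothing here bears on the truth of ⟨24077⟩, the wall W7 or Navier–Stokes
regularity (OPEN / not proved).  pub-ns-dss typer (g39), `--supports stmt-NavierStokesRegularity-24077`.
-/

set_option linter.dupNamespace false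

noncomputable section

open MeasureTheory Set Function Metric Filter Topology
open scoped ENNReal NNReal
open Literature.Analysis Literature.Analysis.FluidPDE

namespace Summit.NavierStokesRegularity.NavierStokesRegularity.Cruxes.TypeIQuantSubcubicExp.FlatChain

/-! ### Scale algebra: `(M/√σ)ⁿ = Mⁿ σ^{-n/2}` -/

/-- `(M/√σ)ⁿ = Mⁿ · σ^{-n/2}` for `σ > 0`. -/
theorem div_sqrt_pow_eq (M : ℝ) {σ : ℝ} (hσ : 0 < σ) (n : ℕ) :
    (M / Real.sqrt σ) ^ n = M ^ n * σ ^ (-((n : ℝ) / 2)) := by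
  have hsq : Real.sqrt σ ^ n = σ ^ ((n : ℝ) / 2) := by
    rw [Real.sqrt_eq_rpow, ← Real.rpow_natCast, ← Real.rpow_mul hσ.le]
    congr 1
    ring
  rw [div_pow, hsq, Real.rpow_neg hσ.le, div_eq_mul_inv]

/-- `(M/√σ)¹ = M σ^{-1/2}`. -/
theorem div_sqrt_pow_one (M : ℝ) {σ : ℝ} (hσ : 0 < σ) :
    (M / Real.sqrt σ) ^ (0 + 1) = M * σ ^ (-(1 / 2 : ℝ)) := by
  rw [div_sqrt_pow_eq M hσ]
  norm_num

/-- `(M/√σ)² = M² σ⁻¹`. -/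
theorem div_sqrt_pow_two (M : ℝ) {σ : ℝ} (hσ : 0 < σ) :
    (M / Real.sqrt σ) ^ (1 + 1) = M ^ 2 * σ⁻¹ := by
  rw [div_sqrt_pow_eq M hσ, ← Real.rpow_neg_one]
  norm_num

/-- `(M/√σ)³ = M³ σ^{-3/2}`. -/
theorem div_sqrt_pow_three (M : ℝ) {σ : ℝ} (hσ : 0 < σ) :
    (M / Real.sqrt σ) ^ (2 + 1) = M ^ 3 * σ ^ (-(3 / 2 : ℝ)) := by
  rw [div_sqrt_pow_eq M hσ]
  norm_num

/-! ### S3: the epoch block under the Type-I rate -/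

/-- **Epochs of regularity are free under the Type-I rate** (S3 with its binders displayed): for every `M`
there is `Ce ≥ 1` such that for `D ≥ 8`, in the crux frame with virtual rate `M` (`τ > 0`), every horizon
`t₁ ∈ (0,T]` and scale `0 < s ≤ t₁` carry `EpochBlock Ce D u t₁ s` — global `C¹` bounds for `u` and
`ω = curl u` at the parabolic scale `s/D` on `[t₁ − 4s/D, t₁ − s/D]`.  [KNSS2009 Prop. 4.1 via the tree's
`EmberCensus.norm_iteratedFDeriv_le_of_typeI_far`; Tao2021QuantitativeNS (5.9)] -/
theorem epochBlock_of_typeI (M : ℝ) : ∃ Ce : ℝ, 1 ≤ Ce ∧ ∀ D : ℝ, 8 ≤ D →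
    ∀ (T τ t₁ s : ℝ) (u : ℝ → EuclideanSpace ℝ (Fin 3) → EuclideanSpace ℝ (Fin 3))
      (p : ℝ → EuclideanSpace ℝ (Fin 3) → ℝ),
      (IsClassicalNSSolutionOn (Icc 0 T) 1 0 u p ∧
        ∀ m : ℕ, ∃ C : NNReal, ∀ t ∈ Icc 0 T, eLpNorm (iteratedFDeriv ℝ m (u t)) 2 volume ≤ C) →
      0 < τ →
      (∀ t ∈ Icc 0 T, ∀ x : EuclideanSpace ℝ (Fin 3), ‖u t x‖ ≤ M * (T + τ - t) ^ (-(1 / 2 : ℝ))) →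
      t₁ ∈ Ioc 0 T → 0 < s → s ≤ t₁ → EpochBlock Ce D u t₁ s := by
  obtain ⟨C₀, hC₀0, hC₀⟩ := EmberCensus.norm_iteratedFDeriv_le_of_typeI_far 0
  obtain ⟨C₁, hC₁0, hC₁⟩ := EmberCensus.norm_iteratedFDeriv_le_of_typeI_far 1
  obtain ⟨C₂, hC₂0, hC₂⟩ := EmberCensus.norm_iteratedFDeriv_le_of_typeI_far 2
  set M' : ℝ := max M 1 with hM'
  have hM'1 : 1 ≤ M' := le_max_right _ _
  have hM'0 : 0 < M' := by linarith
  have hMM' : M ≤ M' := le_max_left _ _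
  set κ : ℝ := ‖curlCLM‖ with hκ
  have hκ0 : 0 ≤ κ := by rw [hκ]; exact norm_nonneg curlCLM
  set Cs : ℝ := C₀ + C₁ + C₂ with hCs
  have hCs0 : 0 ≤ Cs := by rw [hCs]; positivity
  have hM'3 : 1 ≤ M' ^ 3 := one_le_pow₀ hM'1
  refine ⟨(1 + κ) * (Cs + 1) * M' ^ 3, ?_, ?_⟩
  · have h1 : (1 : ℝ) ≤ (1 + κ) * (Cs + 1) := by nlinarith
    nlinarith
  intro D hD T τ t₁ s u p hframe hτ hrate ht₁ hs hst₁
  -- the parabolic scale of the block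
  set σ : ℝ := s / D with hσ
  have hD0 : 0 < D := by linarith
  have hσ0 : 0 < σ := div_pos hs hD0
  have h8σ : 8 * σ ≤ t₁ := by
    have : 8 * σ ≤ s := by
      rw [hσ, mul_div_assoc', div_le_iff₀ hD0]
      nlinarith
    linarith
  -- the rate with `M' = max M 1 > 0`
  have hrate' : ∀ t ∈ Icc 0 T, ∀ x : EuclideanSpace ℝ (Fin 3),
      ‖u t x‖ ≤ M' * (T + τ - t) ^ (-(1 / 2 : ℝ)) := fun t ht x =>
    (hrate t ht x).trans (mul_le_mul_of_nonneg_right hMM' (Real.rpow_nonneg (by linarith [ht.2]) _))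
  -- the `L²` clause of the frame
  have hL2 : ∃ K : NNReal, ∀ t ∈ Icc 0 T, eLpNorm (u t) 2 volume ≤ K := by
    obtain ⟨K, hK⟩ := hframe.2 0
    refine ⟨K, fun t' ht' => ?_⟩
    have e : eLpNorm (u t') 2 volume = eLpNorm (iteratedFDeriv ℝ 0 (u t')) 2 volume :=
      eLpNorm_congr_norm_ae (Eventually.of_forall fun x => (norm_iteratedFDeriv_zero (𝕜 := ℝ)).symm)
    rw [e]; exact hK t' ht'
  -- the clock at the horizon `t₁ − σ` exceeds `r := √σ`
  set r : ℝ := Real.sqrt σ with hr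
  have hr0 : 0 < r := Real.sqrt_pos.2 hσ0
  have hr2 : r ^ 2 = σ := Real.sq_sqrt hσ0.le
  have hhor : t₁ - σ ≤ T := by linarith [ht₁.2]
  have hclock : r ^ 2 < T + τ - (t₁ - σ) := by rw [hr2]; linarith [ht₁.2]
  intro t ht x
  -- the block lies in the smoothing window `((r/M')², t₁ − σ]`
  have hwin : r ^ 2 / M' ^ 2 < t := by
    have h1 : r ^ 2 / M' ^ 2 ≤ σ := by
      rw [hr2, div_le_iff₀ (by positivity)]
      have : σ * 1 ≤ σ * M' ^ 2 := mul_le_mul_of_nonneg_left (by nlinarith) hσ0.le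
      linarith
    have h2 : t₁ - 4 * (s / D) ≤ t := ht.1
    rw [← hσ] at h2
    linarith
  have htmem : t ∈ Ioc (r ^ 2 / M' ^ 2) (t₁ - σ) := ⟨hwin, by rw [hσ]; exact ht.2⟩
  have htT : t ∈ Icc 0 T := by
    have h2 : t₁ - 4 * (s / D) ≤ t := ht.1
    have h3 : t ≤ t₁ - s / D := ht.2
    rw [← hσ] at h2 h3
    constructor <;> linarith
  -- the three smoothing estimates
  have hD0' : ‖iteratedFDeriv ℝ 0 (u t) x‖ ≤ C₀ * (M' / r) ^ (0 + 1) :=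
    hC₀ hframe.1 hL2 hτ hM'0 hr0 hrate' hhor hclock t htmem x
  have hD1' : ‖iteratedFDeriv ℝ 1 (u t) x‖ ≤ C₁ * (M' / r) ^ (1 + 1) :=
    hC₁ hframe.1 hL2 hτ hM'0 hr0 hrate' hhor hclock t htmem x
  have hD2' : ‖iteratedFDeriv ℝ 2 (u t) x‖ ≤ C₂ * (M' / r) ^ (2 + 1) :=
    hC₂ hframe.1 hL2 hτ hM'0 hr0 hrate' hhor hclock t htmem x
  rw [hr, div_sqrt_pow_one M' hσ0, norm_iteratedFDeriv_zero] at hD0'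
  rw [hr, div_sqrt_pow_two M' hσ0, norm_iteratedFDeriv_one] at hD1'
  rw [hr, div_sqrt_pow_three M' hσ0] at hD2'
  -- the curl estimates (`u t ∈ C²`)
  have hu2 : ContDiff ℝ 2 (u t) := (hframe.1.contDiff_velocity htT).of_le (by norm_cast)
  have hω : ‖vorticity u t x‖ ≤ κ * ‖fderiv ℝ (u t) x‖ := by
    rw [vorticity_apply]; exact norm_curl_le (u t) x
  have hDω : ‖fderiv ℝ (vorticity u t) x‖ ≤ κ * ‖iteratedFDeriv ℝ 2 (u t) x‖ := by
    rw [vorticity_apply]; exact norm_fderiv_curl_le hu2 x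
  -- constants
  have hpow : ∀ {c : ℝ} {n : ℕ}, 0 ≤ c → c ≤ Cs → n ≤ 3 →
      (1 + κ) * (c * M' ^ n) ≤ (1 + κ) * (Cs + 1) * M' ^ 3 := by
    intro c n hc hcs hn
    have hMn : M' ^ n ≤ M' ^ 3 := pow_le_pow_right₀ hM'1 hn
    have h1 : c * M' ^ n ≤ (Cs + 1) * M' ^ 3 :=
      mul_le_mul (by linarith) hMn (pow_nonneg hM'0.le _) (by linarith)
    calc (1 + κ) * (c * M' ^ n) ≤ (1 + κ) * ((Cs + 1) * M' ^ 3) :=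
          mul_le_mul_of_nonneg_left h1 (by linarith)
      _ = (1 + κ) * (Cs + 1) * M' ^ 3 := by ring
  have hpow' : ∀ {c : ℝ} {n : ℕ}, 0 ≤ c → c ≤ Cs → n ≤ 3 →
      c * M' ^ n ≤ (1 + κ) * (Cs + 1) * M' ^ 3 := by
    intro c n hc hcs hn
    refine le_trans ?_ (hpow hc hcs hn)
    have h0 : 0 ≤ c * M' ^ n := mul_nonneg hc (pow_nonneg hM'0.le _)
    nlinarith
  have hC₀s : C₀ ≤ Cs := by rw [hCs]; linarith
  have hC₁s : C₁ ≤ Cs := by rw [hCs]; linarith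
  have hC₂s : C₂ ≤ Cs := by rw [hCs]; linarith
  have hσ1 : 0 ≤ σ ^ (-(1 / 2 : ℝ)) := Real.rpow_nonneg hσ0.le _
  have hσ2 : 0 ≤ σ⁻¹ := inv_nonneg.2 hσ0.le
  have hσ3 : 0 ≤ σ ^ (-(3 / 2 : ℝ)) := Real.rpow_nonneg hσ0.le _
  refine ⟨?_, ?_, ?_, ?_⟩
  · calc ‖u t x‖ ≤ C₀ * (M' * σ ^ (-(1 / 2 : ℝ))) := hD0'
      _ = C₀ * M' ^ 1 * σ ^ (-(1 / 2 : ℝ)) := by ring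
      _ ≤ (1 + κ) * (Cs + 1) * M' ^ 3 * σ ^ (-(1 / 2 : ℝ)) :=
          mul_le_mul_of_nonneg_right (hpow' hC₀0 hC₀s (by norm_num)) hσ1
      _ = (1 + κ) * (Cs + 1) * M' ^ 3 * (s / D) ^ (-(1 / 2 : ℝ)) := by rw [hσ]
  · calc ‖fderiv ℝ (u t) x‖ ≤ C₁ * (M' ^ 2 * σ⁻¹) := hD1'
      _ = C₁ * M' ^ 2 * σ⁻¹ := by ring
      _ ≤ (1 + κ) * (Cs + 1) * M' ^ 3 * σ⁻¹ :=
          mul_le_mul_of_nonneg_right (hpow' hC₁0 hC₁s (by norm_num)) hσ2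
      _ = (1 + κ) * (Cs + 1) * M' ^ 3 * (s / D)⁻¹ := by rw [hσ]
  · calc ‖vorticity u t x‖ ≤ κ * ‖fderiv ℝ (u t) x‖ := hω
      _ ≤ κ * (C₁ * (M' ^ 2 * σ⁻¹)) := mul_le_mul_of_nonneg_left hD1' hκ0
      _ = κ * (C₁ * M' ^ 2) * σ⁻¹ := by ring
      _ ≤ (1 + κ) * (C₁ * M' ^ 2) * σ⁻¹ := by
          refine mul_le_mul_of_nonneg_right ?_ hσ2
          have h0 : 0 ≤ C₁ * M' ^ 2 := mul_nonneg hC₁0 (pow_nonneg hM'0.le _)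
          nlinarith
      _ ≤ (1 + κ) * (Cs + 1) * M' ^ 3 * σ⁻¹ :=
          mul_le_mul_of_nonneg_right (hpow hC₁0 hC₁s (by norm_num)) hσ2
      _ = (1 + κ) * (Cs + 1) * M' ^ 3 * (s / D)⁻¹ := by rw [hσ]
  · calc ‖fderiv ℝ (vorticity u t) x‖ ≤ κ * ‖iteratedFDeriv ℝ 2 (u t) x‖ := hDω
      _ ≤ κ * (C₂ * (M' ^ 3 * σ ^ (-(3 / 2 : ℝ)))) := mul_le_mul_of_nonneg_left hD2' hκ0
      _ = κ * (C₂ * M' ^ 3) * σ ^ (-(3 / 2 : ℝ)) := by ring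
      _ ≤ (1 + κ) * (C₂ * M' ^ 3) * σ ^ (-(3 / 2 : ℝ)) := by
          refine mul_le_mul_of_nonneg_right ?_ hσ3
          have h0 : 0 ≤ C₂ * M' ^ 3 := mul_nonneg hC₂0 (pow_nonneg hM'0.le _)
          nlinarith
      _ ≤ (1 + κ) * (Cs + 1) * M' ^ 3 * σ ^ (-(3 / 2 : ℝ)) :=
          mul_le_mul_of_nonneg_right (hpow hC₂0 hC₂s le_rfl) hσ3
      _ = (1 + κ) * (Cs + 1) * M' ^ 3 * (s / D) ^ (-(3 / 2 : ℝ)) := by rw [hσ]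

/-- **S3 `stub_typeIEpoch : TypeIEpoch`** — the registered stub of LINE `flat_chain` v1.1, BY NAME
(`TypeIEpoch` = the Defs-home constant, verbatim the line's §Obligation Props text). -/
theorem stub_typeIEpoch : TypeIEpoch := fun M => epochBlock_of_typeI M

end Summit.NavierStokesRegularity.NavierStokesRegularity.Cruxes.TypeIQuantSubcubicExp.FlatChain

end
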